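import Summits.NavierStokesRegularity.FluidComputer.PalasekTowerGermHostPotentialTruncation
import Summits.NavierStokesRegularity.NavierStokesRegularity.Theorems.PalasekTowerBreakdownEpisodeBaseApproximableAmplifierFreeRun

/-!
# `EpisodeBase` (crux stmt-NavierStokesRegularity-19179) from ONE free run of `curl A`, `A` a SCHWARTZ vector
# potential, and ONE tame free run of the numeric tiny carrier — BY NAME, every static condition closed-form

Cell `ns-blowup`, seat `ns-blowup-ecbridge-3` (g7; D-0074 GROUP C «BRIDGE SUPPORT», lineage `host_preparation`).
Route `PalasekTowerBreakdown`, crux `EpisodeBase`, line `slot` v5. Composition of the potential truncation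
(`Germ.exists_compact_truncation_curl`, `Germ.hasRapidSpatialDecay_curl`) with the approximable-amplifier door
by name (`palasekTowerBreakdown_episodeBase_of_approximable_amplifier_tinyCarrier`). The mechanism is handed over
as a smooth SCHWARTZ vector potential `A` (`HasRapidSpatialDecay A`, e.g. a Gaussian-weighted profile) with
Jacobian bound `‖DA‖ ≤ L`, `4L < Y₀`; the datum `W = curl A` need NOT be compactly supported — its compactly
supported truncations are produced and consumed inside the kernel. LABEL: E–C typing (KERNEL: theorems only;
`--supports` stmt-NavierStokesRegularity-19179). WHAT THIS IS NOT: not Navier–Stokes evidence — no free run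
meeting the letter is exhibited; nothing about `RungG 1` or blow-up is asserted. (A Gaussian-CORED vortex RING
has algebraic Biot–Savart tails and is NOT of this class; type it as `curl (χ_ρ • A)` and use
`palasekTowerBreakdown_episodeBase_of_curl_amplifier_freeRun`.)

* `palasekTowerBreakdown_episodeBase_of_schwartz_potential_amplifier_freeRun` — `0 < a ≤ 11/648`; `A ∈ C^∞`
  Schwartz, `‖DA‖ ≤ L`, `4L < Y₀`; ONE classical finite-energy free run of `strictTinyProfile a` on
  `[1, Host.τfirst]` below `(5/3)Y₁ − η`; ONE classical finite-energy free run of `curl A` on `[1, Host.τfirst]`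
  below `(5/3)Y₁ − η` meeting the three level-`1` faces `+ η` inside `‖x‖ ≤ R` ⟹ `EpisodeBase`.

References: S. Palasek, arXiv:2605.13827 §4 [cite: Palasek2026ElementaryModel, §4]; A. J. Majda, A. L. Bertozzi
(2002) §1.1 (1.11) [cite: MajdaBertozziCUP2002, §1.1 (1.11)].
-/

noncomputable section

-- `Summit.<Summit>.<Problem>` is the tree's mandated summit-side namespace (CONVENTIONS §2); for this
-- single-conjunct summit the two coincide, so the duplicate is deliberate.
set_option linter.dupNamespace false

namespace Summit.NavierStokesRegularity.NavierStokesRegularity.Theorems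

open Set Function MeasureTheory Metric
open scoped ENNReal ContDiff
open Summit.NavierStokesRegularity.NavierStokesRegularity.Theses
open Summit.NavierStokesRegularity.FluidComputer.PalasekTowerClayBridge
open Summit.NavierStokesRegularity.FluidComputer.PalasekTowerClayBridge.Germ
open Literature.Analysis.FluidPDE

/-- **`EpisodeBase` FROM A SCHWARTZ-POTENTIAL AMPLIFIER RUN AND ONE TAME TINY-CARRIER RUN.** Let
`0 < a ≤ 11/648`; `A` smooth and Schwartz (`HasRapidSpatialDecay A`) with `‖DA(x)‖ ≤ L`, `4L < Y₀`; `R ≥ 0`.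
Given ONE classical finite-energy free run (`ν = 1`) of `strictTinyProfile a` on `[1, Host.τfirst]` below
`(5/3) Y₁ − η` and ONE classical finite-energy free run of `curl A` on `[1, Host.τfirst]` below `(5/3) Y₁ − η`
showing at `Host.τfirst`, inside `‖x‖ ≤ R`, speed `≥ Y₁ + η`, gradient `≥ A₁ + η` and an `N₁`-core loop of
circulation `≥ N₁^{β−2} + η` (`η > 0`), `EpisodeBase` holds. [cite: Palasek2026ElementaryModel, §4]
[cite: MajdaBertozziCUP2002, §1.1 (1.11)] -/
theorem palasekTowerBreakdown_episodeBase_of_schwartz_potential_amplifier_freeRun {a : ℝ} (ha : 0 < a)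
    (ha' : a ≤ 11 / 648) {A : EuclideanSpace ℝ (Fin 3) → EuclideanSpace ℝ (Fin 3)} {R L : ℝ}
    (hA : ContDiff ℝ ∞ A) (hAdec : HasRapidSpatialDecay A) (hL : ∀ x, ‖fderiv ℝ A x‖ ≤ L)
    (h4L : 4 * L < TowerRates.wide.Y 0) (hR : 0 ≤ R)
    {v₁ : ℝ → EuclideanSpace ℝ (Fin 3) → EuclideanSpace ℝ (Fin 3)} {q₁ : ℝ → EuclideanSpace ℝ (Fin 3) → ℝ}
    (hv₁ : IsClassicalNSSolutionOn (Icc 1 Host.τfirst) 1 0 v₁ q₁) (hv₁1 : v₁ 1 = strictTinyProfile a)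
    (hv₁E : ∃ C : ℝ≥0∞, C < ⊤ ∧ ∀ t ∈ Icc (1 : ℝ) Host.τfirst, ∫⁻ x, ‖v₁ t x‖ₑ ^ 2 ≤ C)
    {v₂ : ℝ → EuclideanSpace ℝ (Fin 3) → EuclideanSpace ℝ (Fin 3)} {q₂ : ℝ → EuclideanSpace ℝ (Fin 3) → ℝ}
    (hv₂ : IsClassicalNSSolutionOn (Icc 1 Host.τfirst) 1 0 v₂ q₂) (hv₂1 : v₂ 1 = curl A)
    (hv₂E : ∃ C : ℝ≥0∞, C < ⊤ ∧ ∀ t ∈ Icc (1 : ℝ) Host.τfirst, ∫⁻ x, ‖v₂ t x‖ₑ ^ 2 ≤ C)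
    {η : ℝ} (hη : 0 < η)
    (hcap₁ : ∀ t ∈ Icc (1 : ℝ) Host.τfirst, ∀ x, ‖v₁ t x‖ ≤ 5 / 3 * TowerRates.wide.Y 1 - η)
    (hcap₂ : ∀ t ∈ Icc (1 : ℝ) Host.τfirst, ∀ x, ‖v₂ t x‖ ≤ 5 / 3 * TowerRates.wide.Y 1 - η)
    (hspeed : ∃ x, ‖x‖ ≤ R ∧ TowerRates.wide.Y 1 + η ≤ ‖v₂ Host.τfirst x‖)
    (hstrain : ∃ x, ‖x‖ ≤ R ∧ TowerRates.wide.A 1 + η ≤ ‖fderiv ℝ (v₂ Host.τfirst) x‖)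
    (hcore : ∃ (x : EuclideanSpace ℝ (Fin 3)) (γ : ℝ → EuclideanSpace ℝ (Fin 3)),
      ‖x‖ ≤ R ∧ ContDiff ℝ 1 γ ∧ γ 0 = γ 1 ∧
      (∀ s ∈ Icc (0 : ℝ) 1, γ s ∈ closedBall x (1 / TowerRates.wide.N 1)) ∧
      (∀ s ∈ Icc (0 : ℝ) 1, ‖deriv γ s‖ ≤ 8 * Real.pi / TowerRates.wide.N 1) ∧
      TowerRates.wide.N 1 ^ (TowerRates.wide.β - 2) + η ≤ circulation (v₂ Host.τfirst) γ) :
    PalasekTowerBreakdown.EpisodeBase :=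
  palasekTowerBreakdown_episodeBase_of_approximable_amplifier_tinyCarrier ha ha'
    (hasRapidSpatialDecay_curl hA hAdec) hR hv₁ hv₁1 hv₁E hv₂ hv₂1 hv₂E hη hcap₁ hcap₂ hspeed hstrain hcore
    (fun _ hδ => exists_compact_truncation_curl hA hAdec hL h4L R hδ)

end Summit.NavierStokesRegularity.NavierStokesRegularity.Theorems

end
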